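import Mathlib
import HarnessLib
import Summits.HubbardSuperconductivity.HubbardSuperconductivity.Theorems.KLProgrammeKLRegimeEnginePairTransferMemberPHSigned
import Summits.HubbardSuperconductivity.HubbardSuperconductivity.Theorems.KLProgrammeLatticeSoftBubbleModel
import Summits.HubbardSuperconductivity.HubbardSuperconductivity.Theorems.KLProgrammeLatticePeriodicExtension

/-!
# Route `KLProgramme` — ENGINE item stmt-HubbardSuperconductivity-20437 `KLRegimeEngineV17F2`, class-#5 STEP (X).3 rows form (row `hP` of
# `klmd_defect_le_rows_family`): THE SIGNED MEMBER PH ROW, ASSEMBLED — `‖S_P‖ ≤ (βL²)³·(Row(G|p_{x−y}|_𝕋) + Row(G|p_{y−x}|_𝕋)) + ε·flat`,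
# `Row(δ) = ZS·Λₙ₊₁ + thermal·(π/β)/Λₙ₊₁ + transfer·δ/Λₙ₊₁ + lattice/L` keyed on LATTICE kernel data `(A₀, L_A, ε)`
# (cell gate-hubbard-kl, seat hubbard-kl-k3c2-p2 g17, technique «thermal-bar induction n ≤ nScales β + 1»)

Composition of `klms_memberPH_direct_norm_le` (…MemberPHSigned: pinned part `T^±` + flat remainder), `klpe_exists…` (…LatticePeriodicExtension: the momentum-only
weights `Y^±` extend to planar periodic Lipschitz weights `klpeExt Y^± A₀ L_A`, sup `2A₀`, Lipschitz `2L_A`), `klfl_lattice_soft_bubble_norm_le_model`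
(…LatticeSoftBubbleModel: the signed soft forward bubble on the model band at index `n+1`, `q₀ = 0`, transfer `±(x − y)`) and the weight hypotheses of
…EngineFlowSliceWeights (`f = klWdC Λ(t)`: `M_f = 8/Λₙ₊₁`, `ℓ_f = (2B₂+8)/Λₙ₊₁`; `f′ = klPhiC Λ_j Λ(t)`, `n+1 ≤ j`: `M′ = 1`, `ℓ′ = 8·16^{j−(n+1)}`; product `M_F = 8/Λₙ₊₁`).

* `klmsRowBound d A G A₀ L_A β n j δ L` — the row's right side with these constants (a closed real expression; `d = Dt_min`, `A` the frame's `C²` size,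
  `G = 4 + (8/3)Gfr₁U²`, `δ` the band shift); `klTorusNorm_neg`;
* **`klms_memberPH_direct_signed_le`** — for an admissible frame (`FrameOK`, `‖D^{≤2}δ_K‖ ≤ A`, `4A < Dt_min`, `4A ≤ 1/20`, `μ ≤ −0.15`, the index-`n+1` margin
  window), `t ∈ [0,1]`, `n+1 ≤ j`, `klBetaMin ≤ β`, `n+1 ≤ n_β+1`, `M ≥ β·4Λₙ₊₁/(2π) + 1`, small transfer `G·|p_{x−y}|_𝕋 ≤ Λₙ₊₁/8`, and LATTICE kernel data
  (`‖Y^±‖ ≤ A₀`, torus-Lipschitz `L_A`, loop-frequency flatness `ε` on the window `ω² ≤ (4Λₙ₊₁)²`):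
  `‖S_P‖ ≤ (βL²)²·(βL²·Row(G|p_{x−y}|_𝕋) + βL²·Row(G|p_{y−x}|_𝕋)) + ε·(512/3)(βL²)²/Λ(t)²·Σ_p|Φ_j(t)(p)|‖ĝ_K(p)‖`.
Deep members `n+2 ≤ j` should first be reduced to `j = n+2` (`klrf_direct_sum_member_eq_near`, …MemberPHRowForm) so that `ℓ′ ≤ 128`.

Pure composition of landed rows; nothing about the model's effective action is asserted; nothing asserts (X).3, (c), K3 or superconductivity.
-/

noncomputable section

namespace Summit.HubbardSuperconductivity.HubbardSuperconductivity.Theorems.KLRegimeSplit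

set_option linter.dupNamespace false -- summit = problem name (single-conjunct summit), D-0017

open Real Set Finset Complex Literature.MathematicalPhysics.QuantumLattice
open Literature.Probability.LatticeModels hiding torusSupNorm
open Literature.MathematicalPhysics.QuantumLattice.BandSectorCounting
open Summit.HubbardSuperconductivity.HubbardSuperconductivity.Theorems.KLProgrammeLegKernels
open Summit.HubbardSuperconductivity.HubbardSuperconductivity.Theorems.KLRegimeWick
open Summit.HubbardSuperconductivity.HubbardSuperconductivity.Theorems.TwoPointAssembly
open Summit.HubbardSuperconductivity.HubbardSuperconductivity.Theorems.DispersionFlow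
open Summit.HubbardSuperconductivity.HubbardSuperconductivity.Theorems.PerturbedFermiCurve

/-! ## §1 The row bound as a closed expression -/

/-- **The signed member row's right side** at index `n+1` (the right side of `klfl_lattice_soft_bubble_norm_le_model` with the planar weight's data `(2A₀, 2L_A)`,
the slice weight `klWdC Λ(t)` (`M_f = M_F = 8/Λₙ₊₁`, `ℓ_f = (2B₂+8)/Λₙ₊₁`), the partner `klPhiC Λ_j Λ(t)` (`M′ = 1`, `L_d = 8/Λ_j²`, `ℓ′ = 8·16^{j−(n+1)}`),
`q₀ = 0` and band shift `δ`); `d = Dt_min`, `A` = the frame's `C²` size, `G` = the band's Lipschitz constant. -/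
def klmsRowBound (d A G A₀ La β : ℝ) (n j : ℕ) (δ : ℝ) (L : ℕ) : ℝ :=
  ((2 * π) ^ 2)⁻¹ *
      (2 * Real.pi *
        (524288 / Real.pi *
              ((8 / klScale klE0 (n + 1) * (8 / klScale klE0 j ^ 2) +
                    1 * ((2 * (448 / 3 * Real.exp 2) + 8) / klScale klE0 (n + 1) / klScale klE0 (n + 1) ^ 2)) *
                  klScale klE0 (n + 1) ^ 2 +
                8 * (8 / klScale klE0 (n + 1))) *
            (Real.pi * Real.sqrt 2 / (d - 4 * A) * (2 * La + 2 * A₀ * (2 / (1 / 10))) / (d - 4 * A) +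
              2 * A₀ * (1 / (d - 4 * A) ^ 2 + Real.pi * Real.sqrt 2 * (2 + 4 * A) / (d - 4 * A) ^ 3)) * klScale klE0 (n + 1) +
          393216 / Real.pi *
              ((8 / klScale klE0 (n + 1) * (8 / klScale klE0 j ^ 2) +
                    1 * ((2 * (448 / 3 * Real.exp 2) + 8) / klScale klE0 (n + 1) / klScale klE0 (n + 1) ^ 2)) *
                  klScale klE0 (n + 1) ^ 2 +
                8 * (8 / klScale klE0 (n + 1))) *
            (2 * A₀ * (Real.pi * Real.sqrt 2 / (d - 4 * A))) * ((Real.pi / β) / klScale klE0 (n + 1)) +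
          256 / Real.pi * (8 / klScale klE0 (n + 1)) * (2 * A₀ * (Real.pi * Real.sqrt 2 / (d - 4 * A))) *
            ((65 * (8 * (16 : ℝ) ^ (j - (n + 1))) + 17408 / 3 * 1) / klScale klE0 (n + 1) ^ 2 * klScale klE0 (n + 1)) * (|(0 : ℝ)| + δ))) +
    32 * klScale klE0 (n + 1) *
        (2 * La * (2 * (8 / klScale klE0 (n + 1)) / klScale klE0 (n + 1)) * (16 * 1 / klScale klE0 (n + 1)) +
          2 * A₀ * ((9 * ((2 * (448 / 3 * Real.exp 2) + 8) / klScale klE0 (n + 1)) + 4 * (8 / klScale klE0 (n + 1))) / klScale klE0 (n + 1) ^ 2 * G) *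
            (16 * 1 / klScale klE0 (n + 1)) +
          2 * A₀ * (2 * (8 / klScale klE0 (n + 1)) / klScale klE0 (n + 1)) *
            ((65 * (8 * (16 : ℝ) ^ (j - (n + 1))) + 17408 / 3 * 1) / klScale klE0 (n + 1) ^ 2 * G)) / L

/-- `|p_{−q̃}|_𝕋 = |p_q̃|_𝕋`. -/
theorem klTorusNorm_neg {L : ℕ} [NeZero L] (q : TorusSite 2 L) : klTorusNorm L (-q) = klTorusNorm L q := by
  have h1 := klpe_tau_P_sub_P (0 : TorusSite 2 L) q
  have h2 := klpe_tau_P_sub_P q (0 : TorusSite 2 L)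
  rw [zero_sub] at h1
  rw [sub_zero] at h2
  rw [← h1, ← h2, ← klpe_tau_neg, neg_sub]

/-! ## §2 The signed member PH row, assembled -/

section Model

variable {L M : ℕ} [NeZero L] {a' b' : ℝ} (B : BandBounds a' b') {R : RenConsts} {U μ : ℝ} {N : ℕ} {K : TrigPolyC4v} {A : ℝ}

/-- One pinned bubble: the momentum-only weight `Y` (sup `A₀`, torus-Lipschitz `L_A`) against the slice line and the partner `Φ_j(t)` at transfer `q̃`,
`G·|p_q̃|_𝕋 ≤ Λₙ₊₁/8`: `‖Σ_p Y(k̃)·Φ_Ẇ(ω_p, e_K k̃)·Φ_{Φ_j}(ω_p, e_K(k̃ + q̃))‖ ≤ βL²·klmsRowBound … (G·|p_q̃|_𝕋) L`. -/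
theorem klms_pinned_bubble_norm_le (hR : ∀ j, 0 ≤ R.Gfr j) (hK : FrameOK R U N μ K)
    (hAb : ∀ p : Momentum, ∀ j ≤ 2, ‖iteratedFDeriv ℝ j (frameShift K) p‖ ≤ A) (hA : 4 * A < B.Dtmin) (hA20 : 4 * A ≤ 1 / 20) (hμ : μ ≤ -0.15)
    (n : ℕ) {t : ℝ} (ht : t ∈ Icc (0 : ℝ) 1) {j : ℕ} (hj : n + 1 ≤ j)
    (hlo : a' < μ - 4 * klScale klE0 (n + 1) - 4 * A) (hhi : μ + 4 * klScale klE0 (n + 1) + 4 * A < b')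
    {β : ℝ} (hβ : klBetaMin ≤ β) (hn : n + 1 ≤ nScales β + 1) (hM : β * (4 * klScale klE0 (n + 1)) / (2 * Real.pi) + 1 ≤ M)
    (q : TorusSite 2 L) (hq : (4 + 8 / 3 * R.Gfr 1 * U ^ 2) * klTorusNorm L q ≤ klScale klE0 (n + 1) / 8)
    {Y : TorusSite 2 L → ℂ} {A₀ LA : ℝ} (hA0 : 0 ≤ A₀) (hLA : 0 ≤ LA) (hY0 : ∀ k, ‖Y k‖ ≤ A₀)
    (hY1 : ∀ k k', ‖Y k - Y k'‖ ≤ LA * klTorusNorm L (k - k')) :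
    ‖∑ p : FreqMomentum L M, Y p.2 *
        (klfb_prop (klWdC (klScale klE0 n + t * (klScale klE0 (n + 1) - klScale klE0 n))) (matsubaraFreq β M p.1) (nambuXiCT L μ K p.2) *
          klfb_prop (klPhiC (klScale klE0 j) (klScale klE0 n + t * (klScale klE0 (n + 1) - klScale klE0 n))) (matsubaraFreq β M p.1)
            (nambuXiCT L μ K (p.2 + q)))‖ ≤
      β * (L : ℝ) ^ 2 * klmsRowBound B.Dtmin A (4 + 8 / 3 * R.Gfr 1 * U ^ 2) A₀ LA β n j ((4 + 8 / 3 * R.Gfr 1 * U ^ 2) * klTorusNorm L q) L := by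
  set Λt : ℝ := klScale klE0 n + t * (klScale klE0 (n + 1) - klScale klE0 n) with hΛt
  obtain ⟨hlo', hhi'⟩ := scaleAt_mem n ht
  have hΛ1 := klth_klScale_pos (n + 1)
  have hβ0 : 0 < β := lt_of_lt_of_le (by norm_num [klBetaMin]) hβ
  -- the planar weight
  set a : ℝ × ℝ → ℂ := klpeExt Y A₀ LA with ha
  -- the weights' hypotheses at index `n+1`
  obtain ⟨hbd, hlip, hin, hout⟩ := klfw_sliceWeight_hypotheses hlo' hhi'
  obtain ⟨hdbd, hdlip, hdout, -⟩ := klfw_partner_hypotheses hlo' hhi' hj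
  obtain ⟨hFbd, hFlip⟩ := klfw_product_hypotheses hlo' hhi' hj
  have hLf' : 8 / klScale klE0 j ^ 2 ≤ 8 * (16 : ℝ) ^ (j - (n + 1)) / klScale klE0 (n + 1) ^ 2 := (klfw_partner_lipschitz_scale hj).le
  have hLF : 8 / klScale klE0 (n + 1) * (8 / klScale klE0 j ^ 2) + 1 * ((2 * (448 / 3 * Real.exp 2) + 8) / klScale klE0 (n + 1) / klScale klE0 (n + 1) ^ 2) ≤
      (8 / klScale klE0 (n + 1) * (8 / klScale klE0 j ^ 2) + 1 * ((2 * (448 / 3 * Real.exp 2) + 8) / klScale klE0 (n + 1) / klScale klE0 (n + 1) ^ 2)) *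
          klScale klE0 (n + 1) ^ 2 / klScale klE0 (n + 1) ^ 2 :=
    le_of_eq (by rw [mul_div_cancel_right₀ _ (pow_ne_zero 2 hΛ1.ne')])
  have hq₀ : |(0 : ℝ)| ≤ klScale klE0 (n + 1) / 8 := by rw [abs_zero]; positivity
  have h := klfl_lattice_soft_bubble_norm_le_model B hR hK hAb hA hA20 hμ (klpe_continuous_ext Y A₀ hLA) (klpe_ext_periodic₁ Y A₀ LA)
    (klpe_ext_periodic₂ Y A₀ LA) (klpe_norm_ext_le Y hA0 LA) (klpe_ext_lipschitz Y A₀ hLA) (n := n + 1) (Nat.le_add_left 1 n) q hq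
    hlip hbd le_rfl hin hout hdlip hdbd hLf' hdout (by positivity) hFlip hFbd hLF hlo hhi hq₀ hβ hn hM
  -- the normalisation and the lattice values of the planar weight
  have hsum : (∑ p : FreqMomentum L M, Y p.2 *
        (klfb_prop (klWdC Λt) (matsubaraFreq β M p.1) (nambuXiCT L μ K p.2) * klfb_prop (klPhiC (klScale klE0 j) Λt) (matsubaraFreq β M p.1) (nambuXiCT L μ K (p.2 + q)))) =
      (((β * (L : ℝ) ^ 2 : ℝ)) : ℂ) * (β⁻¹ • ∑ i : MatsubaraIdx M, ((L ^ 2 : ℕ) : ℝ)⁻¹ • ∑ k : TorusSite 2 L,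
        a (latticeMomentum L k 0, latticeMomentum L k 1) * klfb_prop (klWdC Λt) (matsubaraFreq β M i) (nambuXiCT L μ K k) *
          klfb_prop (klPhiC (klScale klE0 j) Λt) (matsubaraFreq β M i + 0) (nambuXiCT L μ K (k + q))) := by
    rw [← klrf_sum_freqMomentum_eq_smul hβ0.ne']
    refine Finset.sum_congr rfl fun p _ => ?_
    rw [ha, klpe_ext_apply_latticeMomentum hY0 hY1, add_zero, mul_assoc]
  rw [hsum, norm_mul, Complex.norm_real, Real.norm_of_nonneg (by positivity)]
  refine mul_le_mul_of_nonneg_left ?_ (by positivity)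
  unfold klmsRowBound
  exact h

/-- **THE SIGNED MEMBER PH ROW, ASSEMBLED** (see the module docstring). -/
theorem klms_memberPH_direct_signed_le [NeZero M] (hR : ∀ j, 0 ≤ R.Gfr j) (hK : FrameOK R U N μ K)
    (hAb : ∀ p : Momentum, ∀ j ≤ 2, ‖iteratedFDeriv ℝ j (frameShift K) p‖ ≤ A) (hA : 4 * A < B.Dtmin) (hA20 : 4 * A ≤ 1 / 20) (hμ : μ ≤ -0.15)
    (n : ℕ) {t : ℝ} (ht : t ∈ Icc (0 : ℝ) 1) {β : ℝ} (hβ : klBetaMin ≤ β) (hn : n + 1 ≤ nScales β + 1)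
    (hM : β * (4 * klScale klE0 (n + 1)) / (2 * Real.pi) + 1 ≤ M)
    (Φ : ℕ → ℝ → FreqMomentum L M → ℝ) (hΦ : Φ = fun j t k => (softSymbolCompl L M β μ K (n + 1) j) k + (hubbardCutoffWeightCT L M β μ K (klScale klE0 (n + 1)) k -
            hubbardCutoffWeightCT L M β μ K (klScale klE0 n + t * (klScale klE0 (n + 1) - klScale klE0 n)) k))
    (Wd : ℝ → FreqMomentum L M → ℝ) (hWd : Wd = fun t k => deriv (fun Λ' : ℝ => hubbardCutoffWeightCT L M β μ K Λ' k) (klScale klE0 n + t * (klScale klE0 (n + 1) - klScale klE0 n)))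
    (V : ℕ → ℝ → (Fin 4 → HubbardFieldIdx L M) → ℂ) {j : ℕ} (hj : n + 1 ≤ j) (Qm x y : TorusSite 2 L)
    (hlo : a' < μ - 4 * klScale klE0 (n + 1) - 4 * A) (hhi : μ + 4 * klScale klE0 (n + 1) + 4 * A < b')
    (hq : (4 + 8 / 3 * R.Gfr 1 * U ^ 2) * klTorusNorm L (x - y) ≤ klScale klE0 (n + 1) / 8)
    {A₀ LA ε : ℝ} (hA0 : 0 ≤ A₀) (hLA : 0 ≤ LA) (hε : 0 ≤ ε)
    (hY0p : ∀ k : TorusSite 2 L, ‖∑ σ : Fin 2, V j t ![(((omega0 M, k), σ), 1), (((omega0 M, k + (x - y)), σ), 0), (((omega0 M, y), 0), 0), (((omega0 M, x), 0), 1)] *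
        V j t ![(((omega0 M, k), σ), 0), (((omega0 M, k + (x - y)), σ), 1), ((((omega0 M).rev, Qm - y), 1), 0), ((((omega0 M).rev, Qm - x), 1), 1)]‖ ≤ A₀)
    (hY1p : ∀ k k' : TorusSite 2 L, ‖(∑ σ : Fin 2, V j t ![(((omega0 M, k), σ), 1), (((omega0 M, k + (x - y)), σ), 0), (((omega0 M, y), 0), 0), (((omega0 M, x), 0), 1)] *
          V j t ![(((omega0 M, k), σ), 0), (((omega0 M, k + (x - y)), σ), 1), ((((omega0 M).rev, Qm - y), 1), 0), ((((omega0 M).rev, Qm - x), 1), 1)]) -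
        ∑ σ : Fin 2, V j t ![(((omega0 M, k'), σ), 1), (((omega0 M, k' + (x - y)), σ), 0), (((omega0 M, y), 0), 0), (((omega0 M, x), 0), 1)] *
          V j t ![(((omega0 M, k'), σ), 0), (((omega0 M, k' + (x - y)), σ), 1), ((((omega0 M).rev, Qm - y), 1), 0), ((((omega0 M).rev, Qm - x), 1), 1)]‖ ≤
        LA * klTorusNorm L (k - k'))
    (hY0m : ∀ k : TorusSite 2 L, ‖∑ σ : Fin 2, V j t ![(((omega0 M, k + -(x - y)), σ), 1), (((omega0 M, k), σ), 0), (((omega0 M, y), 0), 0), (((omega0 M, x), 0), 1)] *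
        V j t ![(((omega0 M, k + -(x - y)), σ), 0), (((omega0 M, k), σ), 1), ((((omega0 M).rev, Qm - y), 1), 0), ((((omega0 M).rev, Qm - x), 1), 1)]‖ ≤ A₀)
    (hY1m : ∀ k k' : TorusSite 2 L, ‖(∑ σ : Fin 2, V j t ![(((omega0 M, k + -(x - y)), σ), 1), (((omega0 M, k), σ), 0), (((omega0 M, y), 0), 0), (((omega0 M, x), 0), 1)] *
          V j t ![(((omega0 M, k + -(x - y)), σ), 0), (((omega0 M, k), σ), 1), ((((omega0 M).rev, Qm - y), 1), 0), ((((omega0 M).rev, Qm - x), 1), 1)]) -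
        ∑ σ : Fin 2, V j t ![(((omega0 M, k' + -(x - y)), σ), 1), (((omega0 M, k'), σ), 0), (((omega0 M, y), 0), 0), (((omega0 M, x), 0), 1)] *
          V j t ![(((omega0 M, k' + -(x - y)), σ), 0), (((omega0 M, k'), σ), 1), ((((omega0 M).rev, Qm - y), 1), 0), ((((omega0 M).rev, Qm - x), 1), 1)]‖ ≤
        LA * klTorusNorm L (k - k'))
    (hflat : ∀ (i : MatsubaraIdx M) (σ : Fin 2) (k k' : TorusSite 2 L), matsubaraFreq β M i ^ 2 ≤ (4 * klScale klE0 (n + 1)) ^ 2 →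
      ‖V j t ![(((i, k), σ), 1), (((i, k'), σ), 0), (((omega0 M, y), 0), 0), (((omega0 M, x), 0), 1)] *
            V j t ![(((i, k), σ), 0), (((i, k'), σ), 1), ((((omega0 M).rev, Qm - y), 1), 0), ((((omega0 M).rev, Qm - x), 1), 1)] -
          V j t ![(((omega0 M, k), σ), 1), (((omega0 M, k'), σ), 0), (((omega0 M, y), 0), 0), (((omega0 M, x), 0), 1)] *
            V j t ![(((omega0 M, k), σ), 0), (((omega0 M, k'), σ), 1), ((((omega0 M).rev, Qm - y), 1), 0), ((((omega0 M).rev, Qm - x), 1), 1)]‖ ≤ ε) :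
    ‖∑ p : FreqMomentum L M, ∑ σ : Fin 2, ∑ p' : FreqMomentum L M,
        if matsubaraInt M p'.1 + matsubaraInt M (omega0 M) = matsubaraInt M p.1 + matsubaraInt M (omega0 M) ∧ p'.2 = p.2 + x - y then
          ((((((Φ j t p) : ℝ) : ℂ) * (((β * (L : ℝ) ^ 2 : ℝ) : ℂ) * propCT L M β μ K p)) * ((((Wd t p') : ℝ) : ℂ) * (((β * (L : ℝ) ^ 2 : ℝ) : ℂ) * propCT L M β μ K p'))) +
              (((((Wd t p) : ℝ) : ℂ) * (((β * (L : ℝ) ^ 2 : ℝ) : ℂ) * propCT L M β μ K p)) * ((((Φ j t p') : ℝ) : ℂ) * (((β * (L : ℝ) ^ 2 : ℝ) : ℂ) * propCT L M β μ K p')))) *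
            (V j t ![((p, σ), 1), ((p', σ), 0), (((omega0 M, y), 0), 0), (((omega0 M, x), 0), 1)] *
              V j t ![((p, σ), 0), ((p', σ), 1), ((((omega0 M).rev, Qm - y), 1), 0), ((((omega0 M).rev, Qm - x), 1), 1)])
        else 0‖ ≤
      (β * (L : ℝ) ^ 2) ^ 2 *
          (β * (L : ℝ) ^ 2 * klmsRowBound B.Dtmin A (4 + 8 / 3 * R.Gfr 1 * U ^ 2) A₀ LA β n j ((4 + 8 / 3 * R.Gfr 1 * U ^ 2) * klTorusNorm L (x - y)) L +
            β * (L : ℝ) ^ 2 * klmsRowBound B.Dtmin A (4 + 8 / 3 * R.Gfr 1 * U ^ 2) A₀ LA β n j ((4 + 8 / 3 * R.Gfr 1 * U ^ 2) * klTorusNorm L (x - y)) L) +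
        ε * (512 / 3 * (β * (L : ℝ) ^ 2) ^ 2 / (klScale klE0 n + t * (klScale klE0 (n + 1) - klScale klE0 n)) ^ 2 *
          ∑ p : FreqMomentum L M, |Φ j t p| * ‖propCT L M β μ K p‖) := by
  have hβ0 : 0 < β := lt_of_lt_of_le (by norm_num [klBetaMin]) hβ
  have h0 := klms_memberPH_direct_norm_le β μ K hβ0 n ht Φ hΦ Wd hWd V j Qm x y hε hflat
  refine h0.trans (add_le_add (mul_le_mul_of_nonneg_left (add_le_add ?_ ?_) (by positivity)) le_rfl)
  · exact klms_pinned_bubble_norm_le B hR hK hAb hA hA20 hμ n ht hj hlo hhi hβ hn hM (x - y) hq hA0 hLA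
      (Y := fun k : TorusSite 2 L => ∑ σ : Fin 2, V j t ![(((omega0 M, k), σ), 1), (((omega0 M, k + (x - y)), σ), 0), (((omega0 M, y), 0), 0), (((omega0 M, x), 0), 1)] *
        V j t ![(((omega0 M, k), σ), 0), (((omega0 M, k + (x - y)), σ), 1), ((((omega0 M).rev, Qm - y), 1), 0), ((((omega0 M).rev, Qm - x), 1), 1)])
      hY0p hY1p
  · have hq' : (4 + 8 / 3 * R.Gfr 1 * U ^ 2) * klTorusNorm L (-(x - y)) ≤ klScale klE0 (n + 1) / 8 := by rwa [klTorusNorm_neg]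
    have h := klms_pinned_bubble_norm_le B hR hK hAb hA hA20 hμ n ht hj hlo hhi hβ hn hM (-(x - y)) hq' hA0 hLA
      (Y := fun k : TorusSite 2 L => ∑ σ : Fin 2, V j t ![(((omega0 M, k + -(x - y)), σ), 1), (((omega0 M, k), σ), 0), (((omega0 M, y), 0), 0), (((omega0 M, x), 0), 1)] *
        V j t ![(((omega0 M, k + -(x - y)), σ), 0), (((omega0 M, k), σ), 1), ((((omega0 M).rev, Qm - y), 1), 0), ((((omega0 M).rev, Qm - x), 1), 1)])
      hY0m hY1m
    rw [klTorusNorm_neg] at h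
    exact h

end Model

end Summit.HubbardSuperconductivity.HubbardSuperconductivity.Theorems.KLRegimeSplit

end
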